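import Summits.CriticalPhenomena.CardyFormulaZ2.Theses.CardySelfRefinement
import Summits.CriticalPhenomena.CardyFormulaZ2.Theorems.CardySelfRefinementLagHandOffStopMeasurable
import Literature.Probability.RandomPlanarGeometry.ChordalRestrictionMarkov
import Literature.Probability.RandomPlanarGeometry.ChordalKSCondition
import HarnessLib

/-!
# Markov-kernel bookkeeping: partial helpers for stub `stub_markovPassage` of line
`crosscut-dictionary` for crux `LagHandOff` (stmt-CriticalPhenomena-10268)

Kernel half of the bookkeeping for the set-based domain Markov property
(`ChordalFamily.IsDomainMarkov`: one kernel `Q D past` with `initial`, `markov` at every closed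
`F`, `domain`) of the decoded family `P D := (Ψ D)_* μ`; measure-theoretic half (measurability
of `CurveClass.stopAt F`, per-`F` disintegration): `…LagHandOffStopMeasurable.lean`.

* `isDomainMarkov_iff_exists_slitKernel` — `domain` is a FACTORISATION, not a constraint:
  `IsDomainMarkov P ↔ ∃ K (U; x, b)` (a law per slit-domain configuration: remaining open set,
  tip, target) with `K (D; a, b) = P D` and the disintegration of every `P D` at every closed
  `F` through `K (remainingDomain D past; past.target, b)` (`initial` via
  `remainingDomain_mk_const`, `domain` by construction) — the def-free form of the sibling
  skeleton's `hullKernel` bookkeeping (`Lines/stopping-hull-markov.lean`).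
* `isDomainMarkov_map_of_freshSlitHandOff` — the stub in slit-kernel form: a slit extension
  `Φ (U; x, b) : ℋ_ℂ → CurveClass ℂ` of `Ψ` (same law on `(D.carrier; a, b)`, measurable along
  pasts) with the FRESH-CONFIGURATION hand-off identity on `ℋ_ℂ` gives
  `IsDomainMarkov (fun D => (Ψ D)_* μ)` with `Q D past := (Φ (remainingDomain D past; tip, b))_* μ`
  (change of variables through `measurable_stopAt`).  The hand-off identity is the genuine (XL)
  residual of the stub: the weak limit of the EXACT lattice disintegration at the stopping set
  of explored edges, in interface-lined slit domains — not supplied by a Jordan-domains-only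
  dictionary (the hands-off hypothesis of the registered stub quantifies over
  `ZdDiscretisationFamily D E` of Dobrushin = Jordan domains only).
* `IsMarkovExtension.markov_empty` — at `F = ∅` the clause pins `Q D γ` to "stay at the tip"
  `P D`-a.s. (the standing disprover's `markov_empty`, for every Markov extension);
  `initial_of_markov_singleton` — `initial` FOLLOWS from `markov` at `F = {a}` for probability
  laws of curves starting at `a`.
* `exists_chordalFamily_not_isDomainMarkov` (`no_markovKernel_twoSegments`) — the clause
  `markov` for ALL closed `F` with ONE kernel is NOT vacuous: the probability law
  `½ (δ_[0,1] + δ_[0,2])` on segments admits no kernel serving `F = ∅` and `F = {1}`.  So the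
  content of `IsDomainMarkov` is stopping-set consistency (+ identification of the kernel).

References: W. Werner, Lectures on two-dimensional critical percolation (2007) §3.2 (2);
O. Schramm, Israel J. Math. 118 (2000) §1.
-/

noncomputable section

open MeasureTheory ProbabilityTheory Filter Set Topology
open scoped BoundedContinuousFunction unitInterval ENNReal
open Literature.Probability.Percolation Literature.Probability.LatticeModels
open Literature.Probability.RandomPlanarGeometry Literature.Probability.Percolation.QuadCrossing
open Summit.CriticalPhenomena.CardyFormulaZ2.Theses.CardySelfRefinement

namespace Summit.CriticalPhenomena.CardyFormulaZ2.Cruxes.LagHandOff.CrosscutDictionary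

-- adapted from Lines/stopping-hull-markov.lean (`hullKernel_domain`, `hullKernel_initial`, def-free)
section SlitKernel

/-- **The `domain` clause is a factorisation, not a constraint on `P`.** A chordal family is
domain Markov (`∃ Q, IsMarkovExtension P Q`: `initial`, `markov` at every closed set, `domain`)
iff there is a kernel `K (U; x, b)` indexed by (remaining open set, tip, target) — a law for
every "slit-domain configuration" — which restricts to `P` on Dobrushin domains
(`K (D; a, b) = P D`) and disintegrates every `P D` at every closed `F` through
`K (remainingDomain D γ[0,σ_F]; γ(σ_F), b)`. (`→`: choose, for each `(U, x, b)` hit by some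
`(D, past)`, the value `Q D past`, well defined by `domain`; `←`: `Q D past := K (remainingDomain
D past; past.target, D.pt 1)` satisfies `domain` by construction and `initial` by
`remainingDomain_mk_const`.) This is the exact shape of the intended "fresh-configuration
explorer of the lined slit domain" kernel of lines `crosscut-dictionary` /
`stopping-hull-markov`. [folklore] -/
theorem isDomainMarkov_iff_exists_slitKernel (P : ChordalFamily) :
    P.IsDomainMarkov ↔ ∃ K : Set ℂ → ℂ → ℂ → Measure (CurveClass ℂ),
      (∀ D : DobrushinDomain, K D.carrier (D.pt 0) (D.pt 1) = P D) ∧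
      ∀ (D : DobrushinDomain) (F : Set ℂ), IsClosed F →
        ∀ S T : Set (CurveClass ℂ), MeasurableSet S → MeasurableSet T →
          P D (CurveClass.stopAt F ⁻¹' S ∩ CurveClass.startFrom F ⁻¹' T) =
            ∫⁻ γ in CurveClass.stopAt F ⁻¹' S,
              K (remainingDomain D (γ.stopAt F)) (γ.stopAt F).target (D.pt 1) T ∂(P D) := by
  classical
  constructor
  · rintro ⟨Q, hQ⟩
    have hex : ∀ (D : DobrushinDomain) (p : CurveClass ℂ),
        ∃ Dp : DobrushinDomain × CurveClass ℂ, remainingDomain Dp.1 Dp.2 = remainingDomain D p ∧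
          Dp.2.target = p.target ∧ Dp.1.pt 1 = D.pt 1 := fun D p => ⟨(D, p), rfl, rfl, rfl⟩
    refine ⟨fun U x b =>
      if h : ∃ Dp : DobrushinDomain × CurveClass ℂ,
          remainingDomain Dp.1 Dp.2 = U ∧ Dp.2.target = x ∧ Dp.1.pt 1 = b
      then Q h.choose.1 h.choose.2 else 0, ?_, ?_⟩
    · intro D
      have h := hex D (CurveClass.mk (Curve.const (D.pt 0)))
      rw [remainingDomain_mk_const, CurveClass.target_mk] at h
      have ha : (Curve.const (D.pt 0)).target = D.pt 0 := rfl
      rw [ha] at h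
      dsimp only
      rw [dif_pos h, hQ.domain h.choose.1 D h.choose.2 (CurveClass.mk (Curve.const (D.pt 0)))
        (h.choose_spec.1.trans (remainingDomain_mk_const D).symm) h.choose_spec.2.1
        h.choose_spec.2.2]
      exact hQ.initial D
    · intro D F hF S T hS hT
      rw [hQ.markov D F hF S T hS hT]
      refine lintegral_congr fun γ => ?_
      have h := hex D (γ.stopAt F)
      dsimp only
      rw [dif_pos h, hQ.domain h.choose.1 D h.choose.2 (γ.stopAt F) h.choose_spec.1
        h.choose_spec.2.1 h.choose_spec.2.2]
  · rintro ⟨K, hinit, hmarkov⟩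
    refine ⟨fun D p => K (remainingDomain D p) p.target (D.pt 1), ?_, hmarkov, ?_⟩
    · intro D
      change K (remainingDomain D (CurveClass.mk (Curve.const (D.pt 0))))
        (CurveClass.mk (Curve.const (D.pt 0))).target (D.pt 1) = P D
      rw [remainingDomain_mk_const, CurveClass.target_mk]
      exact hinit D
    · intro D₁ D₂ p₁ p₂ hR ht hb
      rw [hR, ht, hb]

/-- **The Markov passage in slit-kernel form (reshaped `stub_markovPassage`).** If a reading
`Ψ D : ℋ_ℂ → CurveClass ℂ` of interfaces in Dobrushin domains extends to a reading
`Φ (U; x, b) : ℋ_ℂ → CurveClass ℂ` of interfaces in slit-domain configurations (same law on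
`(D.carrier; a, b)`), measurably along pasts, and the law `μ` on `ℋ_ℂ` satisfies the
**fresh-configuration hand-off** — the law of (initial segment, final segment) of `Ψ D` at the
first hitting of every closed `F` disintegrates through the law of `Φ` of the remaining slit
domain read on an INDEPENDENT copy of `μ` — then the decoded family `P D := (Ψ D)_* μ` is domain
Markov in the tree's set-based sense, with Markov extension
`Q D past := (Φ (remainingDomain D past; past.target, D.pt 1))_* μ`. Pure bookkeeping
(`isDomainMarkov_iff_exists_slitKernel` + change of variables, which is where measurability of
`CurveClass.stopAt F` enters); the content of the stub is the hypothesis `hfresh`, the weak limit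
of the EXACT lattice disintegration at the stopping set of explored edges. [folklore] -/
theorem isDomainMarkov_map_of_freshSlitHandOff
    (Ψ : DobrushinDomain → QuadConfig (Set.univ : Set ℂ) → CurveClass ℂ)
    (Φ : Set ℂ → ℂ → ℂ → QuadConfig (Set.univ : Set ℂ) → CurveClass ℂ)
    (μ : Measure (QuadConfig (Set.univ : Set ℂ)))
    (hΨ : ∀ D : DobrushinDomain, Measurable (Ψ D))
    (hext : ∀ D : DobrushinDomain, μ.map (Φ D.carrier (D.pt 0) (D.pt 1)) = μ.map (Ψ D))
    (hmeas : ∀ (D : DobrushinDomain) (T : Set (CurveClass ℂ)), MeasurableSet T →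
      Measurable fun p : CurveClass ℂ => μ.map (Φ (remainingDomain D p) p.target (D.pt 1)) T)
    (hfresh : ∀ (D : DobrushinDomain) (F : Set ℂ), IsClosed F →
      ∀ S T : Set (CurveClass ℂ), MeasurableSet S → MeasurableSet T →
        μ ((Ψ D) ⁻¹' (CurveClass.stopAt F ⁻¹' S ∩ CurveClass.startFrom F ⁻¹' T)) =
          ∫⁻ ω in (Ψ D) ⁻¹' (CurveClass.stopAt F ⁻¹' S),
            μ.map (Φ (remainingDomain D ((Ψ D ω).stopAt F)) ((Ψ D ω).stopAt F).target (D.pt 1))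
              T ∂μ) :
    ChordalFamily.IsDomainMarkov
      (fun D => (μ : Measure (QuadConfig (Set.univ : Set ℂ))).map (Ψ D)) := by
  refine (isDomainMarkov_iff_exists_slitKernel _).mpr ⟨fun U x b => μ.map (Φ U x b), hext, ?_⟩
  intro D F hF S T hS hT
  have hA : MeasurableSet (CurveClass.stopAt F ⁻¹' S ∩ CurveClass.startFrom F ⁻¹' T) :=
    (measurableSet_preimage_stopAt hF hS).inter (measurableSet_preimage_startFrom hF hT)
  have hg : Measurable fun p : CurveClass ℂ =>
      μ.map (Φ (remainingDomain D (p.stopAt F)) (p.stopAt F).target (D.pt 1)) T :=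
    (hmeas D T hT).comp (measurable_stopAt hF)
  change (μ.map (Ψ D)) _ = ∫⁻ γ in CurveClass.stopAt F ⁻¹' S, _ ∂(μ.map (Ψ D))
  rw [Measure.map_apply (hΨ D) hA, hfresh D F hF S T hS hT,
    setLIntegral_map (measurableSet_preimage_stopAt hF hS) hg (hΨ D)]

end SlitKernel

section MarkovEmpty

/-- **The `markov` clause at `F = ∅` (the disprover's `markov_empty` constraint), for any
Markov extension:** with nothing to hit the past is the whole curve and the future is the
constant curve at its target, so `P D (S ∩ {γ | [const γ.target] ∈ T}) = ∫⁻_S Q D γ T d(P D)`: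
`Q D γ` is `P D`-a.s. the Dirac mass at the constant curve at `γ.target` (on completed curves the
kernel "stays at the tip"). [folklore] -/
theorem IsMarkovExtension.markov_empty {P : ChordalFamily}
    {Q : DobrushinDomain → CurveClass ℂ → Measure (CurveClass ℂ)} (hQ : P.IsMarkovExtension Q)
    (D : DobrushinDomain) {S T : Set (CurveClass ℂ)} (hS : MeasurableSet S)
    (hT : MeasurableSet T) :
    P D (S ∩ {γ | CurveClass.mk (Curve.const γ.target) ∈ T}) = ∫⁻ γ in S, Q D γ T ∂(P D) := by
  have h := hQ.markov D ∅ isClosed_empty S T hS hT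
  have h1 : CurveClass.stopAt (∅ : Set ℂ) ⁻¹' S = S := by
    ext c
    rw [mem_preimage, stopAt_empty]
  have h2 : CurveClass.startFrom (∅ : Set ℂ) ⁻¹' T =
      {γ | CurveClass.mk (Curve.const γ.target) ∈ T} := by
    ext c
    rw [mem_preimage, startFrom_empty, mem_setOf_eq]
  rw [h1, h2] at h
  rw [h]
  exact lintegral_congr fun γ => by rw [stopAt_empty]

end MarkovEmpty

section Initial

/-- **The `initial` clause follows from `markov` at `F = {a}` for chordal laws.** If `P` is a
probability law on planar curve classes almost all of which start at `a`, and `Q` disintegrates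
`P` at the first hitting of the closed set `{a}` (the `markov` clause at `F = {a}`), then
`Q [const a] = P`: a curve starting in `F` is stopped immediately (`stopAt {a} γ = [const a]`,
`startFrom {a} γ = γ`), so the disintegration reads `P T = Q [const a] T · P univ`. Hence for a
chordal family the clause `initial` of `IsMarkovExtension` carries no content beyond `markov`.
[folklore] -/
theorem initial_of_markov_singleton {P : Measure (CurveClass ℂ)} [IsProbabilityMeasure P]
    {a : ℂ} (hsrc : ∀ᵐ γ ∂P, γ.source = a) {Q : CurveClass ℂ → Measure (CurveClass ℂ)}
    (hmarkov : ∀ S T : Set (CurveClass ℂ), MeasurableSet S → MeasurableSet T →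
      P (CurveClass.stopAt {a} ⁻¹' S ∩ CurveClass.startFrom {a} ⁻¹' T) =
        ∫⁻ γ in CurveClass.stopAt {a} ⁻¹' S, Q (γ.stopAt {a}) T ∂P) :
    Q (CurveClass.mk (Curve.const a)) = P := by
  have hstop : ∀ᵐ γ ∂P, γ.stopAt {a} = CurveClass.mk (Curve.const a) := by
    filter_upwards [hsrc] with γ hγ
    rw [CurveClass.stopAt_eq_of_source_mem (F := {a}) (hγ ▸ mem_singleton a), hγ]
  have hstart : ∀ᵐ γ ∂P, γ.startFrom {a} = γ := by
    filter_upwards [hsrc] with γ hγ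
    exact CurveClass.startFrom_eq_self_of_source_mem (F := {a}) (hγ ▸ mem_singleton a)
  ext T hT
  have h := hmarkov univ T MeasurableSet.univ hT
  rw [preimage_univ, univ_inter, Measure.restrict_univ] at h
  have h1 : P (CurveClass.startFrom {a} ⁻¹' T) = P T := by
    refine measure_congr ?_
    filter_upwards [hstart] with γ hγ
    change (γ ∈ CurveClass.startFrom {a} ⁻¹' T) = (γ ∈ T)
    rw [mem_preimage, hγ]
  have h2 : ∫⁻ γ, Q (γ.stopAt {a}) T ∂P = Q (CurveClass.mk (Curve.const a)) T := by
    have hae : (fun γ : CurveClass ℂ => Q (γ.stopAt {a}) T) =ᵐ[P]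
        fun _ => Q (CurveClass.mk (Curve.const a)) T :=
      hstop.mono fun γ hγ => by
        change Q (γ.stopAt {a}) T = Q (CurveClass.mk (Curve.const a)) T
        rw [hγ]
    rw [lintegral_congr_ae hae, lintegral_const, measure_univ, mul_one]
  rw [← h1, h, h2]

end Initial

section NonVacuous

/-! ### The `markov` clause has teeth: a two-atom law with no Markov kernel
(contrast the "(nearly) vacuous … any law admits some past-kernel" remark of
`ChordalRestrictionMarkov.lean`, which is right about `domain`/`initial` only). -/

/-- Curve surgery of the straight segments `[0,1] ⊆ [0,2]` at the point `1`: `[0,2]` stops to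
`[0,1]` and restarts as `[1,2]`; `[0,1]` stops to itself and restarts as `const 1`. [folklore] -/
theorem segment_surgery (γ₁ γ₂ γ₃ : Curve ℂ) (h₁ : ∀ s : I, γ₁ s = (s : ℝ))
    (h₂ : ∀ s : I, γ₂ s = 2 * (s : ℝ)) (h₃ : ∀ s : I, γ₃ s = 1 + (s : ℝ)) :
    γ₂.stopAt {1} = γ₁ ∧ γ₂.startFrom {1} = γ₃ ∧ γ₁.stopAt {1} = γ₁ ∧
      γ₁.startFrom {1} = Curve.const 1 := by
  -- hitting parameters: `σ(γ₂) = 1/2`, `σ(γ₁) = 1`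
  have hhalf : (1 / 2 : ℝ) ∈ I := ⟨by norm_num, by norm_num⟩
  have hmem₂ : γ₂ ⟨1 / 2, hhalf⟩ ∈ ({1} : Set ℂ) := by
    rw [mem_singleton_iff, h₂]; push_cast; ring
  have hin₂ := Curve.apply_hitParam_mem isClosed_singleton (γ := γ₂) ⟨_, hmem₂⟩
  rw [mem_singleton_iff, h₂] at hin₂
  have hσ₂ : γ₂.hitParam ({1} : Set ℂ) = 1 / 2 := by
    have h2 : (γ₂.hitParam ({1} : Set ℂ) : ℂ) = (1 / 2 : ℝ) := by
      push_cast; linear_combination hin₂ / 2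
    exact_mod_cast h2
  have hmem₁ : γ₁ 1 ∈ ({1} : Set ℂ) := by
    rw [mem_singleton_iff, h₁]; push_cast; ring
  have hin₁ := Curve.apply_hitParam_mem isClosed_singleton (γ := γ₁) ⟨_, hmem₁⟩
  rw [mem_singleton_iff, h₁] at hin₁
  have hσ₁ : γ₁.hitParam ({1} : Set ℂ) = 1 := by exact_mod_cast hin₁
  refine ⟨?_, ?_, ?_, ?_⟩ <;> refine Curve.ext (ContinuousMap.ext fun s => ?_)
  · change γ₂.stopAt {1} s = γ₁ s
    have hs : 1 / 2 * (s : ℝ) ∈ Icc (0 : ℝ) 1 := ⟨by nlinarith [s.2.1], by nlinarith [s.2.2]⟩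
    rw [Curve.stopAt_apply, hσ₂, projIcc_of_mem _ hs, h₂, h₁]
    push_cast; ring
  · change γ₂.startFrom {1} s = γ₃ s
    have hs : 1 / 2 + (1 - 1 / 2) * (s : ℝ) ∈ Icc (0 : ℝ) 1 :=
      ⟨by nlinarith [s.2.1], by nlinarith [s.2.2]⟩
    rw [Curve.startFrom_apply, hσ₂, projIcc_of_mem _ hs, h₂, h₃]
    push_cast; ring
  · change γ₁.stopAt {1} s = γ₁ s
    rw [Curve.stopAt_apply, hσ₁, one_mul, projIcc_val]
  · change γ₁.startFrom {1} s = 1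
    rw [Curve.startFrom_apply, hσ₁, sub_self, zero_mul, add_zero, projIcc_right, h₁]
    push_cast; ring

/-- **No Markov kernel for the two-atom law `δ_[0,1] + δ_[0,2]`.** If `c₁ = [γ₁]`, `c₂ = [γ₂]`
are the classes of the straight segments `[0,1] ⊆ [0,2]` then no `Q` satisfies the `markov`
clause for `δ_{c₁} + δ_{c₂}` at both `F = ∅` and `F = {1}`: testing `F = ∅` on `S = {c₁}`
gives `Q c₁ univ = 1 = Q c₁ {[const 1]}`, testing `F = {1}` on `S = {c₁}`, `T = {[1,2]}` gives
`2 · Q c₁ {[1,2]} = 1`. [folklore] -/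
theorem no_markovKernel_twoSegments (γ₁ γ₂ γ₃ : Curve ℂ) (h₁ : ∀ s : I, γ₁ s = (s : ℝ))
    (h₂ : ∀ s : I, γ₂ s = 2 * (s : ℝ)) (h₃ : ∀ s : I, γ₃ s = 1 + (s : ℝ))
    (Q : CurveClass ℂ → Measure (CurveClass ℂ))
    (h : ∀ F : Set ℂ, IsClosed F → ∀ S T : Set (CurveClass ℂ), MeasurableSet S →
      MeasurableSet T →
      (Measure.dirac (CurveClass.mk γ₁) + Measure.dirac (CurveClass.mk γ₂))
          (CurveClass.stopAt F ⁻¹' S ∩ CurveClass.startFrom F ⁻¹' T) =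
        ∫⁻ γ in CurveClass.stopAt F ⁻¹' S, Q (γ.stopAt F) T
          ∂(Measure.dirac (CurveClass.mk γ₁) + Measure.dirac (CurveClass.mk γ₂))) :
    False := by
  classical
  obtain ⟨e₂, g₂, e₁, g₁⟩ := segment_surgery γ₁ γ₂ γ₃ h₁ h₂ h₃
  set c₁ := CurveClass.mk γ₁ with hc₁
  set c₂ := CurveClass.mk γ₂ with hc₂
  set c₃ := CurveClass.mk γ₃ with hc₃
  set c₀ := CurveClass.mk (Curve.const (1 : ℂ)) with hc₀
  -- endpoints distinguish the classes
  have t₁ : c₁.target = 1 := by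
    rw [hc₁, CurveClass.target_mk, Curve.target_def, h₁]; push_cast; ring
  have t₂ : c₂.target = 2 := by
    rw [hc₂, CurveClass.target_mk, Curve.target_def, h₂]; push_cast; ring
  have t₃ : c₃.target = 2 := by
    rw [hc₃, CurveClass.target_mk, Curve.target_def, h₃]; push_cast; ring
  have t₀ : c₀.target = 1 := rfl
  have h21 : c₂ ≠ c₁ := fun h => by
    have := congrArg CurveClass.target h; rw [t₁, t₂] at this; norm_num at this
  have h03 : c₀ ≠ c₃ := fun h => by
    have := congrArg CurveClass.target h; rw [t₀, t₃] at this; norm_num at this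
  -- surgery at `{1}` on classes
  have s₁ : c₁.stopAt {1} = c₁ := by
    rw [hc₁, CurveClass.stopAt_mk_holds _ isClosed_singleton, e₁]
  have s₂ : c₂.stopAt {1} = c₁ := by
    rw [hc₂, hc₁, CurveClass.stopAt_mk_holds _ isClosed_singleton, e₂]
  have f₁ : c₁.startFrom {1} = c₀ := by
    rw [hc₁, hc₀, CurveClass.startFrom_mk_holds _ isClosed_singleton, g₁]
  have f₂ : c₂.startFrom {1} = c₃ := by
    rw [hc₂, hc₃, CurveClass.startFrom_mk_holds _ isClosed_singleton, g₂]
  have ms : ∀ c : CurveClass ℂ, MeasurableSet ({c} : Set (CurveClass ℂ)) :=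
    fun c => measurableSet_singleton c
  have n21 : c₂ ∉ ({c₁} : Set (CurveClass ℂ)) := fun h => h21 (mem_singleton_iff.1 h)
  -- (i) F = ∅, S = {c₁}, T = univ : Q c₁ univ = 1
  have r1 := h ∅ isClosed_empty {c₁} univ (ms c₁) MeasurableSet.univ
  have pre1 : CurveClass.stopAt (∅ : Set ℂ) ⁻¹' ({c₁} : Set (CurveClass ℂ)) = {c₁} := by
    ext c; rw [mem_preimage, stopAt_empty]
  rw [pre1, preimage_univ, inter_univ, Measure.restrict_add, lintegral_add_measure,
    setLIntegral_dirac, setLIntegral_dirac, if_pos (mem_singleton c₁), if_neg n21, add_zero,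
    stopAt_empty, Measure.add_apply, Measure.dirac_apply_of_mem (mem_singleton c₁),
    Measure.dirac_apply, indicator_of_notMem n21, add_zero] at r1
  -- (ii) F = ∅, S = {c₁}, T = {c₀} : Q c₁ {c₀} = 1
  have r2 := h ∅ isClosed_empty {c₁} {c₀} (ms c₁) (ms c₀)
  have pre2 : CurveClass.stopAt (∅ : Set ℂ) ⁻¹' ({c₁} : Set (CurveClass ℂ)) ∩
      CurveClass.startFrom (∅ : Set ℂ) ⁻¹' {c₀} = {c₁} := by
    ext c
    simp only [mem_inter_iff, mem_preimage, mem_singleton_iff, stopAt_empty, startFrom_empty]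
    constructor
    · exact fun hc => hc.1
    · intro hc; subst hc; exact ⟨rfl, by rw [t₁]⟩
  rw [pre2, pre1, Measure.restrict_add, lintegral_add_measure,
    setLIntegral_dirac, setLIntegral_dirac, if_pos (mem_singleton c₁), if_neg n21, add_zero,
    stopAt_empty, Measure.add_apply, Measure.dirac_apply_of_mem (mem_singleton c₁),
    Measure.dirac_apply, indicator_of_notMem n21, add_zero] at r2
  -- (iii) F = {1}, S = {c₁}, T = {c₃} : Q c₁ {c₃} + Q c₁ {c₃} = 1
  have r3 := h {1} isClosed_singleton {c₁} {c₃} (ms c₁) (ms c₃)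
  have m₁ : c₁ ∈ CurveClass.stopAt ({1} : Set ℂ) ⁻¹' ({c₁} : Set (CurveClass ℂ)) := by
    rw [mem_preimage, s₁]; exact mem_singleton c₁
  have m₂ : c₂ ∈ CurveClass.stopAt ({1} : Set ℂ) ⁻¹' ({c₁} : Set (CurveClass ℂ)) := by
    rw [mem_preimage, s₂]; exact mem_singleton c₁
  have a₁ : c₁ ∉ CurveClass.stopAt ({1} : Set ℂ) ⁻¹' ({c₁} : Set (CurveClass ℂ)) ∩
      CurveClass.startFrom ({1} : Set ℂ) ⁻¹' {c₃} := by
    rintro ⟨-, hf⟩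
    rw [mem_preimage, f₁] at hf
    exact h03 (mem_singleton_iff.1 hf)
  have a₂ : c₂ ∈ CurveClass.stopAt ({1} : Set ℂ) ⁻¹' ({c₁} : Set (CurveClass ℂ)) ∩
      CurveClass.startFrom ({1} : Set ℂ) ⁻¹' {c₃} := by
    refine ⟨m₂, ?_⟩
    rw [mem_preimage, f₂]; exact mem_singleton c₃
  rw [Measure.restrict_add, lintegral_add_measure, setLIntegral_dirac, setLIntegral_dirac,
    if_pos m₁, if_pos m₂, s₁, s₂, Measure.add_apply, Measure.dirac_apply,
    indicator_of_notMem a₁, Measure.dirac_apply_of_mem a₂, zero_add] at r3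
  -- `Q c₁ {c₀} + Q c₁ {c₃} ≤ Q c₁ univ = 1` forces `Q c₁ {c₃} = 0`, contradicting (iii)
  have hle : Q c₁ {c₀} + Q c₁ {c₃} ≤ Q c₁ univ := by
    rw [← measure_union (disjoint_singleton.2 h03) (ms c₃)]
    exact measure_mono (subset_univ _)
  rw [← r1, ← r2] at hle
  have h0 : Q c₁ {c₃} = 0 :=
    nonpos_iff_eq_zero.1 (ENNReal.le_of_add_le_add_left ENNReal.one_ne_top (by simpa using hle))
  rw [h0, add_zero] at r3
  exact one_ne_zero r3

/-- **`IsDomainMarkov` is not vacuous**: there is a chordal family of PROBABILITY laws (the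
constant family `½ (δ_[0,1] + δ_[0,2])`) admitting no Markov extension at all — already the
`markov` clauses at `F = ∅` and `F = {1}` are incompatible.  So "any law admits some past-kernel"
(docstring of `ChordalRestrictionMarkov.lean`) is false as stated: the content of the set-based
domain Markov property is stopping-set CONSISTENCY of one kernel across all closed `F` (plus the
identification of that kernel, for limits of lattice interfaces, with the law of the explorer of
the remaining slit domain). [folklore] -/
theorem exists_chordalFamily_not_isDomainMarkov :
    ∃ P : ChordalFamily, (∀ D : DobrushinDomain, IsProbabilityMeasure (P D)) ∧
      ¬ P.IsDomainMarkov := by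
  classical
  let γ₁ : Curve ℂ := ⟨⟨fun s : I => ((s : ℝ) : ℂ), by fun_prop⟩⟩
  let γ₂ : Curve ℂ := ⟨⟨fun s : I => 2 * ((s : ℝ) : ℂ), by fun_prop⟩⟩
  let γ₃ : Curve ℂ := ⟨⟨fun s : I => 1 + ((s : ℝ) : ℂ), by fun_prop⟩⟩
  set P₀ : Measure (CurveClass ℂ) :=
    Measure.dirac (CurveClass.mk γ₁) + Measure.dirac (CurveClass.mk γ₂) with hP₀
  have htwo : P₀ univ = 2 := by
    rw [hP₀, Measure.add_apply, measure_univ, measure_univ]; norm_num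
  refine ⟨fun _ => (2 : ℝ≥0∞)⁻¹ • P₀, fun _ => ⟨?_⟩, ?_⟩
  · rw [Measure.smul_apply, htwo, smul_eq_mul, ENNReal.inv_mul_cancel two_ne_zero
      ENNReal.ofNat_ne_top]
  · rintro ⟨Q, hQ⟩
    refine no_markovKernel_twoSegments γ₁ γ₂ γ₃ (fun _ => rfl) (fun _ => rfl) (fun _ => rfl)
      (Q DobrushinDomain.unitDisc) fun F hF S T hS hT => ?_
    have h := hQ.markov DobrushinDomain.unitDisc F hF S T hS hT
    rw [Measure.smul_apply, Measure.restrict_smul, lintegral_smul_measure, smul_eq_mul,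
      smul_eq_mul] at h
    exact (ENNReal.mul_right_inj (ENNReal.inv_ne_zero.2 ENNReal.ofNat_ne_top)
      (ENNReal.inv_ne_top.2 two_ne_zero)).1 h

end NonVacuous

/-- **Registered sub-goal `stub_markovPassage_slitKernel` of `stub_markovPassage`**: the
set-based domain Markov property in slit-kernel form (`isDomainMarkov_iff_exists_slitKernel`).
[folklore] -/
theorem stub_markovPassage_slitKernel : ∀ P : ChordalFamily, P.IsDomainMarkov ↔ ∃ K : Set ℂ → ℂ → ℂ → Measure (CurveClass ℂ), (∀ D : DobrushinDomain, K D.carrier (D.pt 0) (D.pt 1) = P D) ∧ ∀ (D : DobrushinDomain) (F : Set ℂ), IsClosed F → ∀ S T : Set (CurveClass ℂ), MeasurableSet S → MeasurableSet T → P D (CurveClass.stopAt F ⁻¹' S ∩ CurveClass.startFrom F ⁻¹' T) = ∫⁻ γ in CurveClass.stopAt F ⁻¹' S, K (remainingDomain D (γ.stopAt F)) (γ.stopAt F).target (D.pt 1) T ∂(P D) :=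
  isDomainMarkov_iff_exists_slitKernel

end Summit.CriticalPhenomena.CardyFormulaZ2.Cruxes.LagHandOff.CrosscutDictionary

end
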